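import Literature.MathematicalPhysics.QuantumFieldTheory.Balaban1983to89.Beta.RemainderLimitTorusHolo
import Literature.MathematicalPhysics.QuantumFieldTheory.Balaban1983to89.Beta.RemainderDecay190

/-!
# `Beta.RemainderLocalityHolo` — the torus leaf lists with (1.7)-factorization (`RemainderLocality.PolLeavesTFac`) and
# with the (190)-side data (`RemainderDecay190.PolLeavesTFac190`) in HOLOMORPHIC currency, and their reduction to
# `RemainderLimitTorusHolo.PolLeavesTLocH`

Cell pub-balaban, β-function sub-cell, BINDER row D4 (unit `b2b-balaban-beta-an4` gen 49, row D4 OWNER; record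
`HOME/b2b-balaban-beta-an4/D4-CRUX-SOCKETS.md` v1.1, design point M1′; census `BETA/REMAINDER-BETA.md` §10.41).

WHY: as in `Beta.RemainderLimitTorusHolo` — the socket's two analyticity leaves `han : AnalyticOnNhd ℂ (EXn n X) (ball 0 α₂)`
([I] (4.4)) and `hF : AnalyticAt ℂ (F Y) 0` ([I] (1.7) restricted functionals) are re-read as complex FRÉCHET
differentiability (`hdiff`, `hFd : ∀ Y, ∃ ρ > 0, DifferentiableOn ℂ (F Y) (ball 0 ρ)`), the currency every producer in the
tree delivers; `B12Decay510Holo` (p249317) supplies the (4.5) Cauchy estimate and `tendsto_mixedDeriv_of_differentiableOn`.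

WHAT IS PROVED (0 sorry; [folklore] bookkeeping + the printed shapes):
* §1 `PolLeavesTFacH` (twin of `RemainderLocality.PolLeavesTFac`), `term_eq_eventually`, **`hloc_of_fac`** ((K4)
  termwise locality from (F1)+(F2), now via `tendsto_mixedDeriv_of_differentiableOn` with the sup bound obtained from
  continuity at 0), `toPolLeavesTLocH`, `tendsto_sum`.
* §2 `PolLeavesTFac190H` (twin of `RemainderDecay190.PolLeavesTFac190`: the p. 282 leaf generated by `Data190`) and
  `toPolLeavesTFacH` (B₃ := Cκ̄_Bcm, δ₀ ≤ τθ — `Data190.hh`).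
* §3 `PolLeavesTLocH.ofAnalytic` (placed in its home namespace), `PolLeavesTFacH.ofAnalytic`, `PolLeavesTFac190H.ofAnalytic`: analytic-currency leaf lists ARE holomorphic-currency
  ones (`AnalyticOnNhd.differentiableOn`, `AnalyticAt.eventually_analyticAt`); chains + ENDs: `Beta.RemainderDecay190HoloChain`.
HONEST FRAMING: a re-threading of the REDUCTION; nothing of Bałaban's asserted; (D4) NOT discharged (instance 0/1);
NOT BetaPertH, NOT continuum, NOT Clay.  HONEST DEPENDENCY: continuum YM on T⁴ ⇐ BetaPertH ∧ nine spine estimates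
(0/9 proved); BetaPertH ⇐ (D1) ∧ (D4) ∧ CAP+tail; G-an2-4 gates asym, D1 and NE2/3/4.
-/

namespace Literature.MathematicalPhysics.QuantumFieldTheory.Balaban1983to89.Beta.RemainderLocalityHolo

open Literature.MathematicalPhysics.QuantumFieldTheory.Balaban1983to89
open FlowStep DagBinding FlowStepRuns
open Literature.MathematicalPhysics.QuantumFieldTheory.Balaban1983to89.B13ScaleTransfer (Pt)
open Literature.MathematicalPhysics.QuantumFieldTheory.Balaban1983to89.B13Resummation (SpRestr Repr213)
open Literature.MathematicalPhysics.QuantumFieldTheory.Balaban1983to89.TreeLengthTorus (TPt TDom proj tsys)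
open Literature.MathematicalPhysics.QuantumFieldTheory.Balaban1983to89.TreeLengthTorusGeometry (TorusStep)
open Literature.MathematicalPhysics.QuantumFieldTheory.Balaban1983to89.B12Decay510 (mixedDeriv)
open Literature.MathematicalPhysics.QuantumFieldTheory.Balaban1983to89.B12Decay510Holo
  (tendsto_mixedDeriv_of_differentiableOn)
open Literature.MathematicalPhysics.QuantumFieldTheory.Balaban1983to89.B12Decay510Torus (distCT nearT)
open Literature.MathematicalPhysics.QuantumFieldTheory.Balaban1983to89.Beta.RemainderChain
open Literature.MathematicalPhysics.QuantumFieldTheory.Balaban1983to89.Beta.RemainderChainLattice (CondsL SignsL)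
open Literature.MathematicalPhysics.QuantumFieldTheory.Balaban1983to89.Beta.RemainderLimitTorus
open Literature.MathematicalPhysics.QuantumFieldTheory.Balaban1983to89.Beta.RemainderLimitTorusHolo
open Literature.MathematicalPhysics.QuantumFieldTheory.Balaban1983to89.Beta.RemainderLocality
  (mixedDeriv_congr_of_eqOn_ball mixedDeriv_comp_clm PolLeavesTFac)
open Literature.MathematicalPhysics.QuantumFieldTheory.Balaban1983to89.Beta.RemainderDecay190
  (Consts190 Data190 PolLeavesTFac190)
open Metric Filter Topology

noncomputable section

variable {d : ℕ}

/-! ## §1 The torus leaf list with (1.7)-factorization — holomorphic currency -/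

/-- **`RemainderLocality.PolLeavesTFac` WITH `han` ↦ `hdiff` AND `hF` ↦ `hFd`**: the torus leaf list with the printed
locality (F1) and the restricted test-configuration limits (F2), the (4.4)-leaf read as complex Fréchet differentiability
on the open α₂-ball and the restricted functionals `F Y` complex-differentiable on SOME ball around 0 (every other field
verbatim).  A HYPOTHESIS structure. [cite: Balaban1987RG1, (1.7) p.261, (4.4) p.281, (1.21) p.264, (4.35) p.290 and (5.1) p.292; Balaban1988RG2Cluster, (2.38) p.20 and (2.13) p.14] -/
structure PolLeavesTFacH (d M : ℕ) [NeZero M] (a : LDom d → Pt d → ℝ) (c : B13.Consts) (ℓ α₂ B₃ : ℝ) where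
  N : ℕ → ℕ
  [hN : ∀ n, NeZero (N n)]
  hNlim : Tendsto N atTop atTop
  W : (n : ℕ) → TorusStep d (N n)
  hsp : ∀ n, SpRestr (W n).toStepData (W n).geom
  hrep : ∀ n, Repr213 (W n).toStepData (W n).geom
  h238 : ∀ n, B13.Bound238With (W n).toStepData c ℓ
  Wn : ℕ → Type
  [instW : ∀ n, NormedAddCommGroup (Wn n)]
  [instWs : ∀ n, NormedSpace ℂ (Wn n)]
  EXn : (n : ℕ) → TDom d (N n) → Wn n → ℂ
  emb : (n : ℕ) → TDom d (N n) → Wn n → (W n).Φ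
  hemb : ∀ n X, ∀ v ∈ ball (0 : Wn n) α₂, emb n X v ∈ (W n).sp2 X
  hcomp : ∀ n X v, EXn n X v = (W n).Ek1 X (emb n X v)
  hn : (n : ℕ) → TDom d (N n) → TPt d (N n * M) → Wn n
  E2n : (n : ℕ) → TDom d (N n) → TPt d (N n * M) → TPt d (N n * M) → ℝ
  hdiff : ∀ n X, DifferentiableOn ℂ (EXn n X) (ball 0 α₂)
  hrepr : ∀ n X x y, E2n n X x y = (mixedDeriv (EXn n X) (hn n X x) (hn n X y)).re
  hh : ∀ n X x, ‖hn n X x‖ ≤ B₃ * Real.exp (-c.δ₀ * distCT (N n) M x (nearT (M := M) x X))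
  V : LDom d → Type
  [instV : ∀ Y, NormedAddCommGroup (V Y)]
  [instVs : ∀ Y, NormedSpace ℂ (V Y)]
  F : (Y : LDom d) → V Y → ℂ
  hFd : ∀ Y, ∃ ρ > 0, DifferentiableOn ℂ (F Y) (ball 0 ρ)
  r : (n : ℕ) → (Y : LDom d) → Wn n →L[ℂ] V Y
  hfac : ∀ Y : LDom d, ∀ᶠ n in atTop, ∀ v ∈ ball (0 : Wn n) α₂, EXn n (tproj (N n) Y) v = F Y (r n Y v)
  t : (Y : LDom d) → Pt d → V Y
  hconv : ∀ (Y : LDom d) (x : Pt d),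
    Tendsto (fun n => r n Y (hn n (tproj (N n) Y) (proj (N n * M) x))) atTop (𝓝 (t Y x))
  ha : ∀ (Y : LDom d) (z : Pt d), a Y z = (mixedDeriv (F Y) (t Y 0) (t Y z)).re

/-- The carried `NeZero (N n)` witnesses. [folklore] -/
instance PolLeavesTFacH.instNeZeroN {d M : ℕ} [NeZero M] {a : LDom d → Pt d → ℝ} {c : B13.Consts} {ℓ α₂ B₃ : ℝ}
    (Lv : PolLeavesTFacH d M a c ℓ α₂ B₃) (n : ℕ) : NeZero (Lv.N n) := Lv.hN n

/-- The carried normed-group structures of the test-vector spaces. [folklore] -/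
instance PolLeavesTFacH.instNormedAddCommGroupWn {d M : ℕ} [NeZero M] {a : LDom d → Pt d → ℝ} {c : B13.Consts}
    {ℓ α₂ B₃ : ℝ} (Lv : PolLeavesTFacH d M a c ℓ α₂ B₃) (n : ℕ) : NormedAddCommGroup (Lv.Wn n) := Lv.instW n

/-- The carried ℂ-normed-space structures of the test-vector spaces. [folklore] -/
instance PolLeavesTFacH.instNormedSpaceWn {d M : ℕ} [NeZero M] {a : LDom d → Pt d → ℝ} {c : B13.Consts}
    {ℓ α₂ B₃ : ℝ} (Lv : PolLeavesTFacH d M a c ℓ α₂ B₃) (n : ℕ) : NormedSpace ℂ (Lv.Wn n) := Lv.instWs n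

/-- The carried normed-group structures of the restricted-configuration spaces. [folklore] -/
instance PolLeavesTFacH.instNormedAddCommGroupV {d M : ℕ} [NeZero M] {a : LDom d → Pt d → ℝ} {c : B13.Consts}
    {ℓ α₂ B₃ : ℝ} (Lv : PolLeavesTFacH d M a c ℓ α₂ B₃) (Y : LDom d) : NormedAddCommGroup (Lv.V Y) := Lv.instV Y

/-- The carried ℂ-normed-space structures of the restricted-configuration spaces. [folklore] -/
instance PolLeavesTFacH.instNormedSpaceV {d M : ℕ} [NeZero M] {a : LDom d → Pt d → ℝ} {c : B13.Consts}
    {ℓ α₂ B₃ : ℝ} (Lv : PolLeavesTFacH d M a c ℓ α₂ B₃) (Y : LDom d) : NormedSpace ℂ (Lv.V Y) := Lv.instVs Y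

section Leaves

variable {M : ℕ} [NeZero M] {a : LDom d → Pt d → ℝ} {c : B13.Consts} {ℓ α₂ B₃ : ℝ}

/-- A function complex-differentiable on a ball around 0 is bounded on a smaller one (continuity at 0). [folklore] -/
private theorem exists_ball_bound {V : Type*} [NormedAddCommGroup V] [NormedSpace ℂ V] {F : V → ℂ} {ρ : ℝ}
    (hρ : 0 < ρ) (hF : DifferentiableOn ℂ F (ball 0 ρ)) :
    ∃ ρ' > 0, ρ' ≤ ρ ∧ ∀ v ∈ ball (0 : V) ρ', ‖F v‖ ≤ ‖F 0‖ + 1 := by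
  have hc : ContinuousAt F 0 := (hF.differentiableAt (isOpen_ball.mem_nhds (mem_ball_self hρ))).continuousAt
  obtain ⟨δ, hδ, h⟩ := Metric.continuousAt_iff.1 hc 1 one_pos
  refine ⟨min δ ρ, lt_min hδ hρ, min_le_right _ _, fun v hv => ?_⟩
  have hv' : dist v 0 < δ := lt_of_lt_of_le (mem_ball.1 hv) (min_le_left _ _)
  have := h hv'
  rw [dist_eq_norm] at this
  calc ‖F v‖ = ‖F 0 + (F v - F 0)‖ := by ring_nf
    _ ≤ ‖F 0‖ + ‖F v - F 0‖ := norm_add_le _ _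
    _ ≤ ‖F 0‖ + 1 := by linarith [this.le]

/-- **The polarization term of the reduced domain, read through the restriction** (for n large): by (4.35) `hrepr`, germ
invariance (K1) with the factorization (F1) on the α₂-ball, and the chain rule (K2) — holomorphic currency.
[cite: Balaban1987RG1, (1.7) p.261 and (4.35) p.290] -/
theorem PolLeavesTFacH.term_eq_eventually (Lv : PolLeavesTFacH d M a c ℓ α₂ B₃) (hα₂ : 0 < α₂) (Y : LDom d)
    (z : Pt d) :
    ∀ᶠ n in atTop, Lv.E2n n (tproj (Lv.N n) Y) (proj (Lv.N n * M) 0) (proj (Lv.N n * M) z) =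
      (mixedDeriv (Lv.F Y) (Lv.r n Y (Lv.hn n (tproj (Lv.N n) Y) (proj (Lv.N n * M) 0)))
        (Lv.r n Y (Lv.hn n (tproj (Lv.N n) Y) (proj (Lv.N n * M) z)))).re := by
  obtain ⟨ρ, hρ, hρF⟩ := Lv.hFd Y
  have hFd : ∀ y ∈ ball (0 : Lv.V Y) ρ, DifferentiableAt ℂ (Lv.F Y) y :=
    fun y hy => hρF.differentiableAt (isOpen_ball.mem_nhds hy)
  filter_upwards [Lv.hfac Y] with n hfac
  rw [Lv.hrepr, mixedDeriv_congr_of_eqOn_ball hα₂ (fun v hv => hfac v hv), mixedDeriv_comp_clm hρ hFd]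

/-- **(K4) TERMWISE LOCALITY DERIVED — holomorphic currency**: (F1) + (F2) ⟹ the term of the reduction of Y at the
sites 0, z mod N_nM converges to `a Y z = Re ∂²(F Y)(t Y 0, t Y z)` — via `term_eq_eventually` and
`B12Decay510Holo.tendsto_mixedDeriv_of_differentiableOn` on a ball around 0 on which `F Y` is complex-differentiable and
bounded (continuity at 0). [cite: Balaban1987RG1, (1.21) p.264 and (1.7) p.261] -/
theorem PolLeavesTFacH.hloc_of_fac (Lv : PolLeavesTFacH d M a c ℓ α₂ B₃) (hα₂ : 0 < α₂) (Y : LDom d) (z : Pt d) :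
    Tendsto (fun n => Lv.E2n n (tproj (Lv.N n) Y) (proj (Lv.N n * M) 0) (proj (Lv.N n * M) z)) atTop
      (𝓝 (a Y z)) := by
  obtain ⟨ρ, hρ, hρF⟩ := Lv.hFd Y
  obtain ⟨ρ', hρ', hle, hS⟩ := exists_ball_bound hρ hρF
  have hF' : DifferentiableOn ℂ (Lv.F Y) (ball 0 ρ') := hρF.mono (ball_subset_ball hle)
  have hlim := (Complex.continuous_re.tendsto _).comp
    (tendsto_mixedDeriv_of_differentiableOn hρ' hF' hS (Lv.hconv Y 0) (Lv.hconv Y z))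
  rw [Lv.ha Y z]
  exact hlim.congr' ((Lv.term_eq_eventually hα₂ Y z).mono fun n h => h.symm)

/-- **`PolLeavesTFacH ⟹ PolLeavesTLocH`** (its field `hloc` a THEOREM). [cite: Balaban1987RG1, (1.21) p.264] -/
def PolLeavesTFacH.toPolLeavesTLocH (Lv : PolLeavesTFacH d M a c ℓ α₂ B₃) (hα₂ : 0 < α₂) :
    PolLeavesTLocH d M a c ℓ α₂ B₃ where
  N := Lv.N
  hN := Lv.hN
  hNlim := Lv.hNlim
  W := Lv.W
  hsp := Lv.hsp
  hrep := Lv.hrep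
  h238 := Lv.h238
  Wn := Lv.Wn
  instW := Lv.instW
  instWs := Lv.instWs
  EXn := Lv.EXn
  emb := Lv.emb
  hemb := Lv.hemb
  hcomp := Lv.hcomp
  hn := Lv.hn
  E2n := Lv.E2n
  hdiff := Lv.hdiff
  hrepr := Lv.hrepr
  hh := Lv.hh
  hloc := Lv.hloc_of_fac hα₂

/-- Hence the (5.1) limit of the SUMS exists and equals `limKernel a`. [cite: Balaban1987RG1, (5.1) p.292 and (1.21) p.264] -/
theorem PolLeavesTFacH.tendsto_sum (Lv : PolLeavesTFacH d M a c ℓ α₂ B₃) (hC : CondsL d c ℓ) (h22 : c.R22gen ℓ)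
    (hs : SignsL c α₂ B₃) (z : Pt d) :
    Summable (fun Y => a Y z) ∧
      Tendsto (fun n => ∑ X : TDom d (Lv.N n), Lv.E2n n X (proj (Lv.N n * M) 0) (proj (Lv.N n * M) z)) atTop
        (𝓝 (limKernel a z)) :=
  let h := (Lv.toPolLeavesTLocH hs.α₂_pos).tendsto_sum hC h22 hs z
  ⟨h.1, h.2.2⟩

end Leaves

/-! ## §2 The torus leaf list with the (190)-side data — holomorphic currency -/

/-- **`RemainderDecay190.PolLeavesTFac190` WITH `han` ↦ `hdiff` AND `hF` ↦ `hFd`** (the p. 282 leaf generated by the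
(190)-side data `D : Data190`; every other field verbatim).  A HYPOTHESIS structure.
[cite: Balaban1987RG1, (1.7) p.261, (1.21) p.264, (4.4) p.281, (4.35) p.290 and p.282; Balaban1988RG2Cluster, (2.38) p.20; Balaban1985Variational, (190) p.308] -/
structure PolLeavesTFac190H (d M : ℕ) [NeZero M] (a : LDom d → Pt d → ℝ) (c : B13.Consts) (ℓ α₂ : ℝ)
    (q : Consts190) where
  N : ℕ → ℕ
  [hN : ∀ n, NeZero (N n)]
  hNlim : Tendsto N atTop atTop
  W : (n : ℕ) → TorusStep d (N n)
  hsp : ∀ n, SpRestr (W n).toStepData (W n).geom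
  hrep : ∀ n, Repr213 (W n).toStepData (W n).geom
  h238 : ∀ n, B13.Bound238With (W n).toStepData c ℓ
  Wn : ℕ → Type
  [instW : ∀ n, NormedAddCommGroup (Wn n)]
  [instWs : ∀ n, NormedSpace ℂ (Wn n)]
  EXn : (n : ℕ) → TDom d (N n) → Wn n → ℂ
  emb : (n : ℕ) → TDom d (N n) → Wn n → (W n).Φ
  hemb : ∀ n X, ∀ v ∈ ball (0 : Wn n) α₂, emb n X v ∈ (W n).sp2 X
  hcomp : ∀ n X v, EXn n X v = (W n).Ek1 X (emb n X v)
  D : Data190 d M N Wn q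
  E2n : (n : ℕ) → TDom d (N n) → TPt d (N n * M) → TPt d (N n * M) → ℝ
  hdiff : ∀ n X, DifferentiableOn ℂ (EXn n X) (ball 0 α₂)
  hrepr : ∀ n X x y, E2n n X x y = (mixedDeriv (EXn n X) (D.hn n X x) (D.hn n X y)).re
  V : LDom d → Type
  [instV : ∀ Y, NormedAddCommGroup (V Y)]
  [instVs : ∀ Y, NormedSpace ℂ (V Y)]
  F : (Y : LDom d) → V Y → ℂ
  hFd : ∀ Y, ∃ ρ > 0, DifferentiableOn ℂ (F Y) (ball 0 ρ)
  r : (n : ℕ) → (Y : LDom d) → Wn n →L[ℂ] V Y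
  hfac : ∀ Y : LDom d, ∀ᶠ n in atTop, ∀ v ∈ ball (0 : Wn n) α₂, EXn n (tproj (N n) Y) v = F Y (r n Y v)
  t : (Y : LDom d) → Pt d → V Y
  hconv : ∀ (Y : LDom d) (x : Pt d),
    Tendsto (fun n => r n Y (D.hn n (tproj (N n) Y) (proj (N n * M) x))) atTop (𝓝 (t Y x))
  ha : ∀ (Y : LDom d) (z : Pt d), a Y z = (mixedDeriv (F Y) (t Y 0) (t Y z)).re

/-- The carried `NeZero (N n)` witnesses. [folklore] -/
instance PolLeavesTFac190H.instNeZeroN {d M : ℕ} [NeZero M] {a : LDom d → Pt d → ℝ} {c : B13.Consts} {ℓ α₂ : ℝ}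
    {q : Consts190} (Lv : PolLeavesTFac190H d M a c ℓ α₂ q) (n : ℕ) : NeZero (Lv.N n) := Lv.hN n

/-- The carried normed-group structures of the test-vector spaces. [folklore] -/
instance PolLeavesTFac190H.instNormedAddCommGroupWn {d M : ℕ} [NeZero M] {a : LDom d → Pt d → ℝ} {c : B13.Consts}
    {ℓ α₂ : ℝ} {q : Consts190} (Lv : PolLeavesTFac190H d M a c ℓ α₂ q) (n : ℕ) : NormedAddCommGroup (Lv.Wn n) :=
  Lv.instW n

/-- The carried ℂ-normed-space structures of the test-vector spaces. [folklore] -/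
instance PolLeavesTFac190H.instNormedSpaceWn {d M : ℕ} [NeZero M] {a : LDom d → Pt d → ℝ} {c : B13.Consts}
    {ℓ α₂ : ℝ} {q : Consts190} (Lv : PolLeavesTFac190H d M a c ℓ α₂ q) (n : ℕ) : NormedSpace ℂ (Lv.Wn n) :=
  Lv.instWs n

/-- The carried normed-group structures of the restricted-configuration spaces. [folklore] -/
instance PolLeavesTFac190H.instNormedAddCommGroupV {d M : ℕ} [NeZero M] {a : LDom d → Pt d → ℝ} {c : B13.Consts}
    {ℓ α₂ : ℝ} {q : Consts190} (Lv : PolLeavesTFac190H d M a c ℓ α₂ q) (Y : LDom d) : NormedAddCommGroup (Lv.V Y) :=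
  Lv.instV Y

/-- The carried ℂ-normed-space structures of the restricted-configuration spaces. [folklore] -/
instance PolLeavesTFac190H.instNormedSpaceV {d M : ℕ} [NeZero M] {a : LDom d → Pt d → ℝ} {c : B13.Consts}
    {ℓ α₂ : ℝ} {q : Consts190} (Lv : PolLeavesTFac190H d M a c ℓ α₂ q) (Y : LDom d) : NormedSpace ℂ (Lv.V Y) :=
  Lv.instVs Y

section Leaves190

variable {M : ℕ} [NeZero M] {a : LDom d → Pt d → ℝ} {c : B13.Consts} {ℓ α₂ : ℝ} {q : Consts190}

/-- **The (190)-side data GIVE the holomorphic-currency leaf list with (1.7)-factorization** with B₃ := Cκ̄_Bcm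
(δ₀ ≤ τθ; the p. 282 leaf `hh` = `Data190.hh`). [cite: Balaban1987RG1, p.282, (1.7) p.261 and (4.35) p.290; Balaban1985Variational, (190) p.308] -/
def PolLeavesTFac190H.toPolLeavesTFacH (Lv : PolLeavesTFac190H d M a c ℓ α₂ q) (hq : q.Valid c.δ₀) :
    PolLeavesTFacH d M a c ℓ α₂ q.B₃ where
  N := Lv.N
  hN := Lv.hN
  hNlim := Lv.hNlim
  W := Lv.W
  hsp := Lv.hsp
  hrep := Lv.hrep
  h238 := Lv.h238
  Wn := Lv.Wn
  instW := Lv.instW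
  instWs := Lv.instWs
  EXn := Lv.EXn
  emb := Lv.emb
  hemb := Lv.hemb
  hcomp := Lv.hcomp
  hn := Lv.D.hn
  E2n := Lv.E2n
  hdiff := Lv.hdiff
  hrepr := Lv.hrepr
  hh := Lv.D.hh hq
  V := Lv.V
  instV := Lv.instV
  instVs := Lv.instVs
  F := Lv.F
  hFd := Lv.hFd
  r := Lv.r
  hfac := Lv.hfac
  t := Lv.t
  hconv := Lv.hconv
  ha := Lv.ha

end Leaves190

/-! ## §3 The analytic-currency leaf lists ARE holomorphic-currency ones -/

section OfAnalytic

variable {M : ℕ} [NeZero M] {a : LDom d → Pt d → ℝ} {c : B13.Consts} {ℓ α₂ B₃ : ℝ} {q : Consts190}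

/-- An `AnalyticAt ℂ F 0` functional is complex-differentiable on some ball around 0. [folklore] -/
private theorem exists_ball_differentiableOn {V : Type*} [NormedAddCommGroup V] [NormedSpace ℂ V] {F : V → ℂ}
    (hF : AnalyticAt ℂ F 0) : ∃ ρ > 0, DifferentiableOn ℂ F (ball 0 ρ) := by
  obtain ⟨ρ, hρ, hρF⟩ := Metric.eventually_nhds_iff_ball.mp hF.eventually_analyticAt
  exact ⟨ρ, hρ, fun y hy => (hρF y hy).differentiableAt.differentiableWithinAt⟩

/-- An analytic-currency leaf list IS a holomorphic-currency one (`AnalyticOnNhd.differentiableOn`). [folklore] -/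
def _root_.Literature.MathematicalPhysics.QuantumFieldTheory.Balaban1983to89.Beta.RemainderLimitTorusHolo.PolLeavesTLocH.ofAnalytic
    (Lv : PolLeavesTLoc d M a c ℓ α₂ B₃) : PolLeavesTLocH d M a c ℓ α₂ B₃ where
  N := Lv.N
  hN := Lv.hN
  hNlim := Lv.hNlim
  W := Lv.W
  hsp := Lv.hsp
  hrep := Lv.hrep
  h238 := Lv.h238
  Wn := Lv.Wn
  instW := Lv.instW
  instWs := Lv.instWs
  EXn := Lv.EXn
  emb := Lv.emb
  hemb := Lv.hemb
  hcomp := Lv.hcomp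
  hn := Lv.hn
  E2n := Lv.E2n
  hdiff := fun n X => (Lv.han n X).differentiableOn
  hrepr := Lv.hrepr
  hh := Lv.hh
  hloc := Lv.hloc

/-- `RemainderLocality.PolLeavesTFac` ⟹ `PolLeavesTFacH`. [folklore] -/
def PolLeavesTFacH.ofAnalytic (Lv : PolLeavesTFac d M a c ℓ α₂ B₃) : PolLeavesTFacH d M a c ℓ α₂ B₃ where
  N := Lv.N
  hN := Lv.hN
  hNlim := Lv.hNlim
  W := Lv.W
  hsp := Lv.hsp
  hrep := Lv.hrep
  h238 := Lv.h238
  Wn := Lv.Wn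
  instW := Lv.instW
  instWs := Lv.instWs
  EXn := Lv.EXn
  emb := Lv.emb
  hemb := Lv.hemb
  hcomp := Lv.hcomp
  hn := Lv.hn
  E2n := Lv.E2n
  hdiff := fun n X => (Lv.han n X).differentiableOn
  hrepr := Lv.hrepr
  hh := Lv.hh
  V := Lv.V
  instV := Lv.instV
  instVs := Lv.instVs
  F := Lv.F
  hFd := fun Y => exists_ball_differentiableOn (Lv.hF Y)
  r := Lv.r
  hfac := Lv.hfac
  t := Lv.t
  hconv := Lv.hconv
  ha := Lv.ha

/-- `RemainderDecay190.PolLeavesTFac190` ⟹ `PolLeavesTFac190H`. [folklore] -/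
def PolLeavesTFac190H.ofAnalytic (Lv : PolLeavesTFac190 d M a c ℓ α₂ q) : PolLeavesTFac190H d M a c ℓ α₂ q where
  N := Lv.N
  hN := Lv.hN
  hNlim := Lv.hNlim
  W := Lv.W
  hsp := Lv.hsp
  hrep := Lv.hrep
  h238 := Lv.h238
  Wn := Lv.Wn
  instW := Lv.instW
  instWs := Lv.instWs
  EXn := Lv.EXn
  emb := Lv.emb
  hemb := Lv.hemb
  hcomp := Lv.hcomp
  D := Lv.D
  E2n := Lv.E2n
  hdiff := fun n X => (Lv.han n X).differentiableOn
  hrepr := Lv.hrepr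
  V := Lv.V
  instV := Lv.instV
  instVs := Lv.instVs
  F := Lv.F
  hFd := fun Y => exists_ball_differentiableOn (Lv.hF Y)
  r := Lv.r
  hfac := Lv.hfac
  t := Lv.t
  hconv := Lv.hconv
  ha := Lv.ha

end OfAnalytic

end

end Literature.MathematicalPhysics.QuantumFieldTheory.Balaban1983to89.Beta.RemainderLocalityHolo
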